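import Summits.BirchSwinnertonDyer.BirchSwinnertonDyer.Theorems.GenusKolyvaginAtTwoPowDvdShaCardAtTwoRTPowDvdShaCardOfGrossWitnessOrth
import Literature.GroupTheory.FiniteAbelian.LevelwisePairingAssembly
import HarnessLib

/-!
# Route `GenusKolyvaginAtTwo`, LINE 18 (L_T `PowDvdShaCardAtTwoRT`, stmt-BirchSwinnertonDyer-23299, ex 23242) — ROAD (E4)'s CLOSERS WITH THE
# SOCKET IN LEVEL-`2^L` FROBENIUS CURRENCY (the shape of gk2-p5 g27's X-ORTH adapter / gk2-p4's one-pair theorem)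

Seat `bsd-line-gk2-p2` g20 (PROVER seat 2/3, cell `bsd-f1-sign2`), `--supports stmt-BirchSwinnertonDyer-23299` (helper; closes nothing).
THEOREMS ONLY (no definition, no named fact, no `sorry`); BSD is not proved by any of this; neither is L_T.

WHAT. `pow_dvd_natCard_sha_of_grossWitness_of_orthogonal(_onHabitat)` (`…RTPowDvdShaCardOfGrossWitnessOrth`) display X-ORTH for classes whose
primes are reported in the MARGIN class `L + kₘ ≤ idx ∧ FrobEqFrobInfty W K (2^(L+kₘ))`.  gk2-p4's one-pair theorem
`ctLevelPairing_pullback_eq_zero_of_opposite_signs` and gk2-p5 g27's adapter speak `FrobEqFrobInfty W K (2^L)` (the regular frame at the pairing's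
auxiliary level `2^L = m·m`).  Since the provenance predicate occurs only POSITIVELY in the supply clauses, the margin currency converts to the
level-`2^L` currency by `FrobEqFrobInfty.of_dvd` (`2^L ∣ 2^(L+kₘ)`).  This file states the two closers with the socket in that currency:
**`pow_dvd_natCard_sha_of_grossWitness_of_orthogonalL`** (`2N`-form (NPh)) and **`…_onHabitatL`** (cut habitat): L_T's conclusion
`2^{2M₀} ∣ #Ш(E_K)[2^∞]` from a Gross witness, displayed ONLY {P (Kolyvagin conjunct), Q2, a bi-additive `B` on `Ш(E_K)[2^k]` with the level clause,
X-ORTH: `B(x, x′) = 0` for `x` of (+)-provenance and `x′` of (−)-provenance, provenance = «`= ι(2^{L−e} c_L(n))`, `e ≤ k`, `n` square-free with primes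
`ZK ∧ L ≤ idx ∧ FrobEqFrobInfty W K (2^L)`, the class Selmer, vanishing at its own primes, of sign `±w(E)`»}.

References: [McCallumLMS1991] §4 Prop. 4.7, §5 Prop. 5.2, Thm. 5.4; [Kolyvagin1991StructureSha]; [GrossLMS1991] §3 (3.1)–(3.3), §5 Prop. 5.3–5.4.
-/

set_option autoImplicit false
-- the Theorems namespace of this sub repeats the summit name by design (D-0017 nested layout)
set_option linter.dupNamespace false

noncomputable section

open scoped Classical
open scoped AddSubgroup

namespace Summit.BirchSwinnertonDyer.BirchSwinnertonDyer.Theorems.GenusExact.PlusDescent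

open WeierstrassCurve NumberField IsDedekindDomain Field Literature.NumberTheory.EllipticCurves
  Literature.NumberTheory.GaloisRepresentations Literature.NumberTheory.EllipticCurves.ModularForms AddSubgroup
open Summit.BirchSwinnertonDyer.BirchSwinnertonDyer.Theses.GenusKolyvaginAtTwo (KolyvaginRelationAtTwo)
open Summit.BirchSwinnertonDyer.Rank1Residual

variable {K : Type} [Field K] [NumberField K]

/-- **The capstone's level clause from the tree's `IsLevelPairing`** (Milne I Lemma 6.17 shape: `B(x, ·) = 0 ⟹ x ∈ qG`; the canonical
Cassels–Tate level pairing `ctLevelPairing … canonical` is one by `isLevelPairing_ctLevelPairing_canonical`). [cite: MilneADT2006, Ch. I §6 Lemma 6.17] -/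
theorem levelClause_of_isLevelPairing {G : Type*} [AddCommGroup G] (q : ℕ)
    (B : ↥(G[(q : ℤ)]) →+ ↥(G[(q : ℤ)]) →+ AddCircle (1 : ℚ)) (hB : Literature.GroupTheory.FiniteAbelian.IsLevelPairing q B)
    (x : ↥(G[(q : ℤ)])) (hx : B x = 0) : ∃ z : G, q • z = (x : G) :=
  (hB.2 x).mp fun y ↦ by rw [hx, AddMonoidHom.zero_apply]

/-- Monotonicity of the margin currency: the supplied primes' `FrobEqFrobInfty W K (2^(L+kₘ))` gives `FrobEqFrobInfty W K (2^L)`. [folklore] -/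
theorem frobEqFrobInfty_pow_of_margin (W : WeierstrassCurve ℚ) (K : Type) [Field K] [NumberField K] {L kₘ ℓ : ℕ}
    (h : FrobEqFrobInfty W K (2 ^ (L + kₘ)) ℓ) : FrobEqFrobInfty W K (2 ^ L) ℓ :=
  FrobEqFrobInfty.of_dvd (W := W) (K := K) (pow_dvd_pow 2 (Nat.le_add_right L kₘ)) h

/-- **THE (E4) CLOSER, `2N`-form, socket in level-`2^L` Frobenius currency.**  As `pow_dvd_natCard_sha_of_grossWitness_of_orthogonal` with X-ORTH
displayed for provenance primes `ZK ∧ L ≤ idx ∧ FrobEqFrobInfty W K (2^L)` (gk2-p4/gk2-p5's shape). Conclusion: `2^{2M₀} ∣ #Ш(E_K)[2^∞]`.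
[cite: McCallumLMS1991, §4 Prop. 4.7, §5 Prop. 5.2, Thm. 5.4 (p. 310)] [cite: Kolyvagin1991StructureSha] [cite: GrossLMS1991, §3 (3.1)–(3.3), §5 Prop. 5.3–5.4] -/
theorem pow_dvd_natCard_sha_of_grossWitness_of_orthogonalL (hP : PubInputsAtTwo) (hQ2 : KolyvaginRelationAtTwo)
    (W : WeierstrassCurve ℚ) [W.IsElliptic] [W.IsGloballyMinimal] [NeZero (W.conductorNorm ℤ)] (hcm : ¬ W.HasCM)
    (hT : Odd W.tamagawaProduct) (hΔ : W.Δ < 0) (K : Type) [Field K] [NumberField K] (hIQ : IsImaginaryQuadratic K)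
    (hodd : Odd (NumberField.discr K)) (h3 : NumberField.discr K ≠ -3) (hHe : SatisfiesHeegnerHypothesis (W.conductorNorm ℤ) K)
    (hns : ¬ IsSquare ((NumberField.discr K : ℚ) * -|W.Δ|))
    (hρ : ∀ n : ℕ, 0 < n → W.HasSurjectiveModNGaloisRep ((2 : ℤ) ^ n))
    (Dt : ModularParametrizationData W (W.conductorNorm ℤ)) (β : ℤ) (ι : K →+* ℂ) (d₁ : KolyvaginHeegnerData Dt β ι 1)
    (hy : ¬ IsOfFinAddOrder d₁.derivedPoint) (M₀ : ℕ)
    (hM₀ : ∃ Q : (W.baseChange (ringClassField K ι 1)).toAffine.Point, ((2 ^ M₀ : ℕ) : ℤ) • Q = d₁.derivedPoint)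
    (hndiv : ¬ ∃ Q : (W.baseChange (ringClassField K ι 1)).toAffine.Point, ((2 ^ (M₀ + 1) : ℕ) : ℤ) • Q = d₁.derivedPoint)
    (τ : K ≃ₐ[ℚ] K) (hτ : τ ≠ 1) (L kₘ k : ℕ) (hL : 2 * M₀ + 12 ≤ L) (hkₘ : 1 ≤ kₘ) (hkM : M₀ ≤ k)
    (hNPh : ∀ z : galH1Torsion (W.baseChange K) ((2 ^ (L + kₘ) : ℕ) : ℤ),
      (∀ ρ ∈ torsionFixing (W.baseChange K) ((2 ^ (L + kₘ) : ℕ) : ℤ),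
        h1Eval (W.baseChange K) ((2 ^ (L + kₘ) : ℕ) : ℤ) z ρ = 0) →
      (∀ w : HeightOneSpectrum (𝓞 K), ((2 * W.conductorNorm ℤ : ℕ) : 𝓞 K) ∈ w.asIdeal →
        z ∈ selmerLocalKer (W.baseChange K) (w.adicCompletion K) ((2 ^ (L + kₘ) : ℕ) : ℤ)) → z = 0)
    {n₀ : ℕ} (hn₀ : Squarefree n₀)
    (hn₀K : ∀ q ∈ n₀.primeFactors, Zhang2014.IsKolyvaginPrime (W.conductorNorm ℤ) W K 2 q ∧ 2 ≤ Zhang2014.kolyvaginIndex W 2 q ∧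
      FrobEqFrobInfty W K (2 ^ 2) q)
    (e₀ : KolyvaginHeegnerData Dt β ι n₀) (he₀ : addOrderOf (e₀.kolyvaginClass Nat.prime_two 2) = 2 ^ 2)
    (B : ↥((↥(W.baseChange K).sha)[((2 ^ k : ℕ) : ℤ)]) →+ ↥((↥(W.baseChange K).sha)[((2 ^ k : ℕ) : ℤ)]) →+ AddCircle (1 : ℚ))
    (hker : ∀ x : ↥((↥(W.baseChange K).sha)[((2 ^ k : ℕ) : ℤ)]), B x = 0 →
      ∃ z : (W.baseChange K).sha, (2 ^ k) • z = (x : (W.baseChange K).sha))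
    (hOrth : ∀ x x' : ↥((↥(W.baseChange K).sha)[((2 ^ k : ℕ) : ℤ)]),
      (∃ (n : ℕ) (d : KolyvaginHeegnerData Dt β ι n) (e : ℕ), Squarefree n ∧
        (∀ ℓ ∈ n.primeFactors, Zhang2014.IsKolyvaginPrime (W.conductorNorm ℤ) W K 2 ℓ ∧ L ≤ Zhang2014.kolyvaginIndex W 2 ℓ ∧
          FrobEqFrobInfty W K (2 ^ L) ℓ) ∧
        e ≤ k ∧
        ((2 ^ (L - e) : ℕ) : ℤ) • d.kolyvaginClass Nat.prime_two L ∈ selmerGroup (W.baseChange K) ((2 ^ L : ℕ) : ℤ) ∧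
        (∀ ℓ ∈ n.primeFactors, ∀ u : HeightOneSpectrum (𝓞 K), ((ℓ : ℕ) : 𝓞 K) ∈ u.asIdeal →
          ((2 ^ (L - e) : ℕ) : ℤ) • d.kolyvaginClass Nat.prime_two L ∈
            (W.baseChange K).torsionLocalKer (u.adicCompletion K) ((2 ^ L : ℕ) : ℤ)) ∧
        conjAct W τ ((2 ^ L : ℕ) : ℤ) (((2 ^ (L - e) : ℕ) : ℤ) • d.kolyvaginClass Nat.prime_two L) =
          W.rootNumber • (((2 ^ (L - e) : ℕ) : ℤ) • d.kolyvaginClass Nat.prime_two L) ∧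
        ((x : (W.baseChange K).sha) : (W.baseChange K).galH1) =
          torsionH1ToH1 (W.baseChange K) ((2 ^ L : ℕ) : ℤ) (((2 ^ (L - e) : ℕ) : ℤ) • d.kolyvaginClass Nat.prime_two L)) →
      (∃ (n : ℕ) (d : KolyvaginHeegnerData Dt β ι n) (e : ℕ), Squarefree n ∧
        (∀ ℓ ∈ n.primeFactors, Zhang2014.IsKolyvaginPrime (W.conductorNorm ℤ) W K 2 ℓ ∧ L ≤ Zhang2014.kolyvaginIndex W 2 ℓ ∧
          FrobEqFrobInfty W K (2 ^ L) ℓ) ∧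
        e ≤ k ∧
        ((2 ^ (L - e) : ℕ) : ℤ) • d.kolyvaginClass Nat.prime_two L ∈ selmerGroup (W.baseChange K) ((2 ^ L : ℕ) : ℤ) ∧
        (∀ ℓ ∈ n.primeFactors, ∀ u : HeightOneSpectrum (𝓞 K), ((ℓ : ℕ) : 𝓞 K) ∈ u.asIdeal →
          ((2 ^ (L - e) : ℕ) : ℤ) • d.kolyvaginClass Nat.prime_two L ∈
            (W.baseChange K).torsionLocalKer (u.adicCompletion K) ((2 ^ L : ℕ) : ℤ)) ∧
        conjAct W τ ((2 ^ L : ℕ) : ℤ) (((2 ^ (L - e) : ℕ) : ℤ) • d.kolyvaginClass Nat.prime_two L) =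
          (-W.rootNumber) • (((2 ^ (L - e) : ℕ) : ℤ) • d.kolyvaginClass Nat.prime_two L) ∧
        ((x' : (W.baseChange K).sha) : (W.baseChange K).galH1) =
          torsionH1ToH1 (W.baseChange K) ((2 ^ L : ℕ) : ℤ) (((2 ^ (L - e) : ℕ) : ℤ) • d.kolyvaginClass Nat.prime_two L)) →
      B x x' = 0) :
    2 ^ (2 * M₀) ∣ Nat.card (AddCommGroup.primaryComponent (W.baseChange K).sha 2) := by
  refine pow_dvd_natCard_sha_of_grossWitness_of_orthogonal hP hQ2 W hcm hT hΔ K hIQ hodd h3 hHe hns hρ Dt β ι d₁ hy M₀ hM₀ hndiv τ hτ L kₘ k hL hkₘ hkM hNPh hn₀ hn₀K e₀ he₀ B hker (fun x x' hx hx' ↦ ?_)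
  obtain ⟨n, d, e, hn', hKol, he, hsel, hvan, hsg, hx⟩ := hx
  obtain ⟨n', d', e', hn'', hKol', he', hsel', hvan', hsg', hx'⟩ := hx'
  exact hOrth x x' ⟨n, d, e, hn', fun ℓ hℓ ↦ ⟨(hKol ℓ hℓ).1, (hKol ℓ hℓ).2.1, frobEqFrobInfty_pow_of_margin W K (hKol ℓ hℓ).2.2.2⟩,
      he, hsel, hvan, hsg, hx⟩
    ⟨n', d', e', hn'', fun ℓ hℓ ↦ ⟨(hKol' ℓ hℓ).1, (hKol' ℓ hℓ).2.1, frobEqFrobInfty_pow_of_margin W K (hKol' ℓ hℓ).2.2.2⟩,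
      he', hsel', hvan', hsg', hx'⟩

/-- **THE (E4) CLOSER ON THE CUT HABITAT (L_T's rev-33 frame), socket in level-`2^L` Frobenius currency.**  As
`pow_dvd_natCard_sha_of_grossWitness_of_orthogonal_onHabitat` with X-ORTH displayed for provenance primes `ZK ∧ L ≤ idx ∧ FrobEqFrobInfty W K (2^L)`.
Displayed: (P), Q2, `B` + level clause, X-ORTH.  Conclusion: L_T's. [cite: McCallumLMS1991, §4 Prop. 4.7, §5 Prop. 5.2, Thm. 5.4 (p. 310)]
[cite: Kolyvagin1991StructureSha] [cite: GrossLMS1991, §3 (3.3), §5 Prop. 5.3–5.4] [cite: LawsonWuthrich2016, §7.1] -/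
theorem pow_dvd_natCard_sha_of_grossWitness_of_orthogonal_onHabitatL (hP : PubInputsAtTwo) (hQ2 : KolyvaginRelationAtTwo)
    (W : WeierstrassCurve ℚ) [W.IsElliptic] [W.IsGloballyMinimal] [NeZero (W.conductorNorm ℤ)] (hcm : ¬ W.HasCM)
    (hT : Odd W.tamagawaProduct) (hΔ : W.Δ < 0) (K : Type) [Field K] [NumberField K] (hIQ : IsImaginaryQuadratic K)
    (hodd : Odd (NumberField.discr K)) (h3 : NumberField.discr K ≠ -3) (hHe : SatisfiesHeegnerHypothesis (W.conductorNorm ℤ) K)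
    (hns : ¬ IsSquare ((NumberField.discr K : ℚ) * -|W.Δ|))
    (hns₂ : ¬ IsSquare ((NumberField.discr K : ℚ) * (-(2 * |W.Δ|))))
    {v : HeightOneSpectrum (𝓞 ℚ)} (h2v : ((2 : ℕ) : 𝓞 ℚ) ∉ v.asIdeal) (hNv : ((W.conductorNorm ℤ : ℕ) : 𝓞 ℚ) ∈ v.asIdeal)
    (hmult : W.HasMultiplicativeReductionAt v)
    (hρ : ∀ n : ℕ, 0 < n → W.HasSurjectiveModNGaloisRep ((2 : ℤ) ^ n))
    (Dt : ModularParametrizationData W (W.conductorNorm ℤ)) (β : ℤ) (ι : K →+* ℂ) (d₁ : KolyvaginHeegnerData Dt β ι 1)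
    (hy : ¬ IsOfFinAddOrder d₁.derivedPoint) (M₀ : ℕ)
    (hM₀ : ∃ Q : (W.baseChange (ringClassField K ι 1)).toAffine.Point, ((2 ^ M₀ : ℕ) : ℤ) • Q = d₁.derivedPoint)
    (hndiv : ¬ ∃ Q : (W.baseChange (ringClassField K ι 1)).toAffine.Point, ((2 ^ (M₀ + 1) : ℕ) : ℤ) • Q = d₁.derivedPoint)
    (τ : K ≃ₐ[ℚ] K) (hτ : τ ≠ 1) (L kₘ k : ℕ) (hL : 2 * M₀ + 12 ≤ L) (hkₘ : 1 ≤ kₘ) (hkM : M₀ ≤ k)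
    {n₀ : ℕ} (hn₀ : Squarefree n₀)
    (hn₀K : ∀ q ∈ n₀.primeFactors, Zhang2014.IsKolyvaginPrime (W.conductorNorm ℤ) W K 2 q ∧ 2 ≤ Zhang2014.kolyvaginIndex W 2 q ∧
      FrobEqFrobInfty W K 2 q)
    (e₀ : KolyvaginHeegnerData Dt β ι n₀)
    (he₀ : ¬ ∃ Q : (W.baseChange (ringClassField K ι n₀)).toAffine.Point, (2 : ℤ) • Q = e₀.derivedPoint)
    (B : ↥((↥(W.baseChange K).sha)[((2 ^ k : ℕ) : ℤ)]) →+ ↥((↥(W.baseChange K).sha)[((2 ^ k : ℕ) : ℤ)]) →+ AddCircle (1 : ℚ))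
    (hker : ∀ x : ↥((↥(W.baseChange K).sha)[((2 ^ k : ℕ) : ℤ)]), B x = 0 →
      ∃ z : (W.baseChange K).sha, (2 ^ k) • z = (x : (W.baseChange K).sha))
    (hOrth : ∀ x x' : ↥((↥(W.baseChange K).sha)[((2 ^ k : ℕ) : ℤ)]),
      (∃ (n : ℕ) (d : KolyvaginHeegnerData Dt β ι n) (e : ℕ), Squarefree n ∧
        (∀ ℓ ∈ n.primeFactors, Zhang2014.IsKolyvaginPrime (W.conductorNorm ℤ) W K 2 ℓ ∧ L ≤ Zhang2014.kolyvaginIndex W 2 ℓ ∧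
          FrobEqFrobInfty W K (2 ^ L) ℓ) ∧
        e ≤ k ∧
        ((2 ^ (L - e) : ℕ) : ℤ) • d.kolyvaginClass Nat.prime_two L ∈ selmerGroup (W.baseChange K) ((2 ^ L : ℕ) : ℤ) ∧
        (∀ ℓ ∈ n.primeFactors, ∀ u : HeightOneSpectrum (𝓞 K), ((ℓ : ℕ) : 𝓞 K) ∈ u.asIdeal →
          ((2 ^ (L - e) : ℕ) : ℤ) • d.kolyvaginClass Nat.prime_two L ∈
            (W.baseChange K).torsionLocalKer (u.adicCompletion K) ((2 ^ L : ℕ) : ℤ)) ∧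
        conjAct W τ ((2 ^ L : ℕ) : ℤ) (((2 ^ (L - e) : ℕ) : ℤ) • d.kolyvaginClass Nat.prime_two L) =
          W.rootNumber • (((2 ^ (L - e) : ℕ) : ℤ) • d.kolyvaginClass Nat.prime_two L) ∧
        ((x : (W.baseChange K).sha) : (W.baseChange K).galH1) =
          torsionH1ToH1 (W.baseChange K) ((2 ^ L : ℕ) : ℤ) (((2 ^ (L - e) : ℕ) : ℤ) • d.kolyvaginClass Nat.prime_two L)) →
      (∃ (n : ℕ) (d : KolyvaginHeegnerData Dt β ι n) (e : ℕ), Squarefree n ∧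
        (∀ ℓ ∈ n.primeFactors, Zhang2014.IsKolyvaginPrime (W.conductorNorm ℤ) W K 2 ℓ ∧ L ≤ Zhang2014.kolyvaginIndex W 2 ℓ ∧
          FrobEqFrobInfty W K (2 ^ L) ℓ) ∧
        e ≤ k ∧
        ((2 ^ (L - e) : ℕ) : ℤ) • d.kolyvaginClass Nat.prime_two L ∈ selmerGroup (W.baseChange K) ((2 ^ L : ℕ) : ℤ) ∧
        (∀ ℓ ∈ n.primeFactors, ∀ u : HeightOneSpectrum (𝓞 K), ((ℓ : ℕ) : 𝓞 K) ∈ u.asIdeal →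
          ((2 ^ (L - e) : ℕ) : ℤ) • d.kolyvaginClass Nat.prime_two L ∈
            (W.baseChange K).torsionLocalKer (u.adicCompletion K) ((2 ^ L : ℕ) : ℤ)) ∧
        conjAct W τ ((2 ^ L : ℕ) : ℤ) (((2 ^ (L - e) : ℕ) : ℤ) • d.kolyvaginClass Nat.prime_two L) =
          (-W.rootNumber) • (((2 ^ (L - e) : ℕ) : ℤ) • d.kolyvaginClass Nat.prime_two L) ∧
        ((x' : (W.baseChange K).sha) : (W.baseChange K).galH1) =
          torsionH1ToH1 (W.baseChange K) ((2 ^ L : ℕ) : ℤ) (((2 ^ (L - e) : ℕ) : ℤ) • d.kolyvaginClass Nat.prime_two L)) →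
      B x x' = 0) :
    2 ^ (2 * M₀) ∣ Nat.card (AddCommGroup.primaryComponent (W.baseChange K).sha 2) := by
  refine pow_dvd_natCard_sha_of_grossWitness_of_orthogonal_onHabitat hP hQ2 W hcm hT hΔ K hIQ hodd h3 hHe hns hns₂ h2v hNv hmult hρ Dt β ι d₁ hy M₀ hM₀ hndiv τ hτ L kₘ k hL hkₘ hkM hn₀ hn₀K e₀ he₀ B hker (fun x x' hx hx' ↦ ?_)
  obtain ⟨n, d, e, hn', hKol, he, hsel, hvan, hsg, hx⟩ := hx
  obtain ⟨n', d', e', hn'', hKol', he', hsel', hvan', hsg', hx'⟩ := hx'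
  exact hOrth x x' ⟨n, d, e, hn', fun ℓ hℓ ↦ ⟨(hKol ℓ hℓ).1, (hKol ℓ hℓ).2.1, frobEqFrobInfty_pow_of_margin W K (hKol ℓ hℓ).2.2.2⟩,
      he, hsel, hvan, hsg, hx⟩
    ⟨n', d', e', hn'', fun ℓ hℓ ↦ ⟨(hKol' ℓ hℓ).1, (hKol' ℓ hℓ).2.1, frobEqFrobInfty_pow_of_margin W K (hKol' ℓ hℓ).2.2.2⟩,
      he', hsel', hvan', hsg', hx'⟩

/-- **THE (E4) CLOSER ON THE CUT HABITAT for a LEVEL PAIRING** (`IsLevelPairing (2^k) B`: alternating + the Cassels–Tate kernel clause, e.g. the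
canonical `ctLevelPairing` by `isLevelPairing_ctLevelPairing_canonical`), socket in level-`2^L` currency.  Displayed: (P), Q2, X-ORTH for `B`.
Conclusion: L_T's `2^{2M₀} ∣ #Ш(E_K)[2^∞]`. [cite: McCallumLMS1991, §4 Prop. 4.7, §5 Thm. 5.4] [cite: MilneADT2006, Ch. I §6 Lemma 6.17, Thm. 6.13]
[cite: Kolyvagin1991StructureSha] -/
theorem pow_dvd_natCard_sha_of_grossWitness_of_isLevelPairing_onHabitat (hP : PubInputsAtTwo) (hQ2 : KolyvaginRelationAtTwo)
    (W : WeierstrassCurve ℚ) [W.IsElliptic] [W.IsGloballyMinimal] [NeZero (W.conductorNorm ℤ)] (hcm : ¬ W.HasCM)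
    (hT : Odd W.tamagawaProduct) (hΔ : W.Δ < 0) (K : Type) [Field K] [NumberField K] (hIQ : IsImaginaryQuadratic K)
    (hodd : Odd (NumberField.discr K)) (h3 : NumberField.discr K ≠ -3) (hHe : SatisfiesHeegnerHypothesis (W.conductorNorm ℤ) K)
    (hns : ¬ IsSquare ((NumberField.discr K : ℚ) * -|W.Δ|))
    (hns₂ : ¬ IsSquare ((NumberField.discr K : ℚ) * (-(2 * |W.Δ|))))
    {v : HeightOneSpectrum (𝓞 ℚ)} (h2v : ((2 : ℕ) : 𝓞 ℚ) ∉ v.asIdeal) (hNv : ((W.conductorNorm ℤ : ℕ) : 𝓞 ℚ) ∈ v.asIdeal)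
    (hmult : W.HasMultiplicativeReductionAt v)
    (hρ : ∀ n : ℕ, 0 < n → W.HasSurjectiveModNGaloisRep ((2 : ℤ) ^ n))
    (Dt : ModularParametrizationData W (W.conductorNorm ℤ)) (β : ℤ) (ι : K →+* ℂ) (d₁ : KolyvaginHeegnerData Dt β ι 1)
    (hy : ¬ IsOfFinAddOrder d₁.derivedPoint) (M₀ : ℕ)
    (hM₀ : ∃ Q : (W.baseChange (ringClassField K ι 1)).toAffine.Point, ((2 ^ M₀ : ℕ) : ℤ) • Q = d₁.derivedPoint)
    (hndiv : ¬ ∃ Q : (W.baseChange (ringClassField K ι 1)).toAffine.Point, ((2 ^ (M₀ + 1) : ℕ) : ℤ) • Q = d₁.derivedPoint)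
    (τ : K ≃ₐ[ℚ] K) (hτ : τ ≠ 1) (L kₘ k : ℕ) (hL : 2 * M₀ + 12 ≤ L) (hkₘ : 1 ≤ kₘ) (hkM : M₀ ≤ k)
    {n₀ : ℕ} (hn₀ : Squarefree n₀)
    (hn₀K : ∀ q ∈ n₀.primeFactors, Zhang2014.IsKolyvaginPrime (W.conductorNorm ℤ) W K 2 q ∧ 2 ≤ Zhang2014.kolyvaginIndex W 2 q ∧
      FrobEqFrobInfty W K 2 q)
    (e₀ : KolyvaginHeegnerData Dt β ι n₀)
    (he₀ : ¬ ∃ Q : (W.baseChange (ringClassField K ι n₀)).toAffine.Point, (2 : ℤ) • Q = e₀.derivedPoint)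
    (B : ↥((↥(W.baseChange K).sha)[((2 ^ k : ℕ) : ℤ)]) →+ ↥((↥(W.baseChange K).sha)[((2 ^ k : ℕ) : ℤ)]) →+ AddCircle (1 : ℚ))
    (hB : Literature.GroupTheory.FiniteAbelian.IsLevelPairing (2 ^ k) B)
    (hOrth : ∀ x x' : ↥((↥(W.baseChange K).sha)[((2 ^ k : ℕ) : ℤ)]),
      (∃ (n : ℕ) (d : KolyvaginHeegnerData Dt β ι n) (e : ℕ), Squarefree n ∧
        (∀ ℓ ∈ n.primeFactors, Zhang2014.IsKolyvaginPrime (W.conductorNorm ℤ) W K 2 ℓ ∧ L ≤ Zhang2014.kolyvaginIndex W 2 ℓ ∧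
          FrobEqFrobInfty W K (2 ^ L) ℓ) ∧
        e ≤ k ∧
        ((2 ^ (L - e) : ℕ) : ℤ) • d.kolyvaginClass Nat.prime_two L ∈ selmerGroup (W.baseChange K) ((2 ^ L : ℕ) : ℤ) ∧
        (∀ ℓ ∈ n.primeFactors, ∀ u : HeightOneSpectrum (𝓞 K), ((ℓ : ℕ) : 𝓞 K) ∈ u.asIdeal →
          ((2 ^ (L - e) : ℕ) : ℤ) • d.kolyvaginClass Nat.prime_two L ∈
            (W.baseChange K).torsionLocalKer (u.adicCompletion K) ((2 ^ L : ℕ) : ℤ)) ∧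
        conjAct W τ ((2 ^ L : ℕ) : ℤ) (((2 ^ (L - e) : ℕ) : ℤ) • d.kolyvaginClass Nat.prime_two L) =
          W.rootNumber • (((2 ^ (L - e) : ℕ) : ℤ) • d.kolyvaginClass Nat.prime_two L) ∧
        ((x : (W.baseChange K).sha) : (W.baseChange K).galH1) =
          torsionH1ToH1 (W.baseChange K) ((2 ^ L : ℕ) : ℤ) (((2 ^ (L - e) : ℕ) : ℤ) • d.kolyvaginClass Nat.prime_two L)) →
      (∃ (n : ℕ) (d : KolyvaginHeegnerData Dt β ι n) (e : ℕ), Squarefree n ∧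
        (∀ ℓ ∈ n.primeFactors, Zhang2014.IsKolyvaginPrime (W.conductorNorm ℤ) W K 2 ℓ ∧ L ≤ Zhang2014.kolyvaginIndex W 2 ℓ ∧
          FrobEqFrobInfty W K (2 ^ L) ℓ) ∧
        e ≤ k ∧
        ((2 ^ (L - e) : ℕ) : ℤ) • d.kolyvaginClass Nat.prime_two L ∈ selmerGroup (W.baseChange K) ((2 ^ L : ℕ) : ℤ) ∧
        (∀ ℓ ∈ n.primeFactors, ∀ u : HeightOneSpectrum (𝓞 K), ((ℓ : ℕ) : 𝓞 K) ∈ u.asIdeal →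
          ((2 ^ (L - e) : ℕ) : ℤ) • d.kolyvaginClass Nat.prime_two L ∈
            (W.baseChange K).torsionLocalKer (u.adicCompletion K) ((2 ^ L : ℕ) : ℤ)) ∧
        conjAct W τ ((2 ^ L : ℕ) : ℤ) (((2 ^ (L - e) : ℕ) : ℤ) • d.kolyvaginClass Nat.prime_two L) =
          (-W.rootNumber) • (((2 ^ (L - e) : ℕ) : ℤ) • d.kolyvaginClass Nat.prime_two L) ∧
        ((x' : (W.baseChange K).sha) : (W.baseChange K).galH1) =
          torsionH1ToH1 (W.baseChange K) ((2 ^ L : ℕ) : ℤ) (((2 ^ (L - e) : ℕ) : ℤ) • d.kolyvaginClass Nat.prime_two L)) →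
      B x x' = 0) :
    2 ^ (2 * M₀) ∣ Nat.card (AddCommGroup.primaryComponent (W.baseChange K).sha 2) :=
  pow_dvd_natCard_sha_of_grossWitness_of_orthogonal_onHabitatL hP hQ2 W hcm hT hΔ K hIQ hodd h3 hHe hns hns₂ h2v hNv hmult hρ Dt β ι d₁ hy M₀
    hM₀ hndiv τ hτ L kₘ k hL hkₘ hkM hn₀ hn₀K e₀ he₀ B (fun x hx ↦ levelClause_of_isLevelPairing (2 ^ k) B hB x hx) hOrth

end Summit.BirchSwinnertonDyer.BirchSwinnertonDyer.Theorems.GenusExact.PlusDescent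

end
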